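import Literature.MathematicalPhysics.QuantumFieldTheory.Balaban1983to89.B6Ineq2134DiagKLevelL0
import Literature.MathematicalPhysics.QuantumFieldTheory.Balaban1983to89.B6Ineq2134KFamKLevel
/-!
# `Balaban1983to89.B6Ineq2134KFamKLevelL0` — LEVEL-0 TWIN (programme G-F3′-L0, director-ym LINE №27 / UV3-NODE §24.5; plan `lit-balaban-r03/G-F3L0-PLAN.md`) of `B6Ineq2134KFamKLevel`:
the same declarations, SAME NAMES AND STATEMENTS, for nested families WITH print's region `Λ₀ = T ∖ Ω₁` ADMITTED (structures
`B6MultiLevelBoxOperatorL0.Domains` / `B6MultiLevelTorusOperatorL0.TDomains`: levels `0, …, k`, the level-`0` block a single site, `Q′₀ = id`,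
finite weight `a₀` — print p.225 (2.14) «Σ_{j=0}^k … (Q′₀λ)(x) = λ(x), x ∈ Λ₀», p.229 «taking a sequence (2.1) … smallest possible domains B^j(Λ_j),
and considering the operator Δ_a defined by (2.19), (2.20) for this sequence»).  Every `D`-free object is the lineage's, consumed BY NAME; no existing
module is touched; no fact is minted.  Unit `lit-balaban-p33` (p33 gen 89; S-E entry twins named to p33 by the B6 owner r03 gen 36, ruling 2026-08-27T18:45:57Z; port tooling by r03 gen 36); B6 fold owner r03; referee ref-4.  THE TWIN'S DOCUMENTATION FOLLOWS
VERBATIM (its «levels 1 … k» / «Ω₁ = X» sentences describe the twin; here `j` runs from `0` and `Ω₁` may be a proper subset).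

# `Balaban1983to89.B6Ineq2134KFamKLevel` — T. Bałaban, *Propagators and renormalization transformations for lattice gauge theories. II*,
# Commun. Math. Phys. **96** (1984) 223–250 [Balaban1984PropagatorsII], p. 247: (2.134) FOR THE WHOLE KERNEL FAMILY `K_{□,□′}` OF (2.91)–(2.93) ON THE
# GENUINE `k`-LEVEL FAMILY — the hypotheses `h2134` (ALL pairs, ONE `θ₀ = O(M⁻¹)`, ONE rate), `hKout`, `hR` and the smallness `N²θ₀c₁ < 1` of
# `…B6Prop26Gluing.majorant_R_of_2134` / `prop26_2136_of_2133_2134` for `Kt □ □′ := kFam (∂P∂*) h ζ M P □ □′ · G_□′` — `R` LITERALLY `…B6Eq291Generator.rOp`,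
# `∂P∂*` the genuine `k`-level operator (gen 24's `DP i`) — above ONE threshold; and the special case `P_□ = ∂P∂*` with the line-4 partner discharged

statement-level skeleton of published theorems with citation tags; proofs where landed; nothing here is a claim about the Yang–Mills mass gap

PDF held: `paper:balaban1984-cmp96-propagators-rt-ii` (journal page = PDF page + 222); p. 239 [PDF 17] ((2.91)–(2.93)), p. 247 [PDF 25] ((2.134)–(2.135)), p. 238
[PDF 16] ((2.88), the remarks) — read from the tree transcriptions of `…B6Eq291Generator` (p02), `…B6Prop26Gluing` (pv09), `…B6Ineq2134ThetaKLevel` (p38 g24;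
pp. 239/247 re-read as images there) and `…B6Ineq2134DiagKLevel` (p38 g25).  PRINT (p. 239, verbatim): *"Using the formulas (1.126)–(1.128), we get Δ_aG₀ =
I − Σ_{□,□′∈𝒟} K_{□,□′}G_{□′}h_{□′} = I − R, (2.91)"*; p. 247: *"|(K_{□,□′}G_{□′}h_{□′}J)(x)| ≤ O(M^{−1})e^{−½δ₂d(y,y′)}|J| (2.134) for x ∈ Δ(y), supp J ⊂
Δ(y′), and this together with (2.91) implies |(RJ)(x)| ≤ O(M^{−1})e^{−½δ₂d(y,y′)}|J| … (2.135) Reasoning in the same way as in the proof of Proposition 2.2 we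
obtain Proposition 2.6."*

CITATION HEADER (lean-in-tree rule) — WHAT IS REPRODUCED.  Phase-2 file of the `lit-balaban` typed skeleton (HOME `run/shared/lean/pub/lit-balaban/`), seat
**p38 gen 25** (TAKING line HOME/STATUS.md 2026-08-22T21:40Z, «bite (b′)» of B6-CLOSURE §5 item 6, second file; owner r03 g18 no objection 21:57Z); SKELETON
rows **B6.Eq2.134** × **B6.Eq2.91** × **B6.Prop2.6** (cells only; decls of record untouched; referee ref-4).  The consumer `…B6Prop26Gluing.majorant_R_of_2134`
/ `prop26_2136_of_2133_2134(_lemma21)` (pv09) takes, for a cube family `𝒟` with reach sets and overlap number `N`: `h2134` — ONE majorant `θ₀e^{−(δ₂/2)d}` of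
`Kt □ □′·h_{□′}` for ALL pairs —, `hKout` — `Kt □ □′` output-localised to the reach of `□` —, `hR : R = Σ_{□,□′} Kt □ □′·h_{□′}` and `hsmall : N²θ₀c₁ < 1`.
THIS FILE PRODUCES THEM ON THE GENUINE `k`-LEVEL FAMILY `i : KIdx d ℓ` (P7's `geoB i`; gen 24's vector fields `XV i`, block map `blkV i`, genuine `∂P∂* = DP i`)
FOR THE KERNEL FAMILY OF (2.91) BY NAME, `Kt □ □′ := …B6Eq291Generator.kFam (∂P∂*) h ζ M P □ □′ · G_□′` (□ = □′: `kDiag` (2.92); □ ≠ □′: `kOff` (2.93) with the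
derived index `ζ_{□′}`):
* §1 `rOp_eq_sum` — `rOp 𝒟 (∂P∂*) h ζ G M P = Σ_{□,□′} (kFam … □ □′·G_□′)·h_□′` (the consumer's `hR`, definitional, any ring); `outLoc_kDiag_mul`, `outLoc_kOff_mul`,
  **`outLoc_kFam`** — `hKout` on any lattice from `supp h_□`, `supp ζ_□` within the blocks of the window `T_□` and the finite range of `M_□` on `supp h_□`
  (`OutLoc (M_□·h_□) T_□`; p. 239 *"Both operators are defined on the torus T_□"*);
* §2 **`h2134_kFam_kLevel`** — for every rate `δ_G > 0`: `∃ M₀, δ ∈ (0, δ_G], Θ ≥ 0` (on `d, L, δ_G`) such that for every member with `L·M_h ≥ M₀`, all constants,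
  sizes `n_E, n_K` and every cube family with per-cube data — `G_□` on its window `T_□` ((2.133) pair `C_G(L^jη)²e^{−δ_Gd}` / `C₁(L^jη)e^{−δ_Gd}`, output-localised),
  `h_□` (`|h_□| ≤ 1`, supported within the blocks of `S_□ ⊆ T_□`, block-Lipschitz `(s/M)(d + r₀)`), `ζ_□` (`0 ≤ ζ_□ ≤ 1`, `= 1` on the blocks of the core `Score_□`),
  the gap `m·M` between the complement of the core and `S_□` (*"1/3 M"*), the decomposition of `h_□M_□ − M_□h_□` into lines 1–2 of (2.92), the line-2 partners and
  the own projection `P_□` ((2.88)-shape majorants), line 3 `ζ_□(∂P∂* − ∂P_□∂*)h_□` with the change-of-domain majorant `C_De^{−c_DM}(L^jη)^{−2}e^{−δ_Gd}` (p. 238) —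
  FOR ALL (□, □′) ∈ 𝒟²: `HasMajorant (blkV i) ((kFam (∂P∂*) h ζ M P □ □′·G_□′)·h_□′) (θ₀·e^{−(δ/2)d})` with ONE **`θ₀ = Θ·(C_G/m + U)/M`**,
  `U = n_E·s₁C₁ + s₂C_G + (n_K+1)·s·((C_N+1)C_G(1+r₀)) + C_DC_G/c_D` — gen 24's `ineq2134_kOff_kLevel` (□ ≠ □′; (2.88) of the genuine `∂P∂*` discharged there)
  and gen 25's `ineq2134_kDiag_kLevel_theta` (□ = □′) at a common rate and constant;
* §3 **`inputs2134_kFam_kLevel`** — the same bundled with the located smallness `N²θ₀c₁ < 1` (cell SMALLNESS S-B6.3) above ONE threshold (`theta0_lt` of gen 24);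
* §4 `ineq2134_kDiag_kLevel_noDomainChange` — the special case `P_□ = ∂P∂*` (line 3 absent, `…B6Eq291Generator.kDiag_noDomainChange`): the line-4 partner IS the
  genuine `DP i`, its (2.88) majorant DISCHARGED by gen 24's `hasMajorant_DP` (P7 `ineq288_kLevelP` BY NAME); `θ₀ = Θ·U/M`, `δ = min(δ_P, δ_G)`.
IMPORTS BY NAME, restating nothing; no `def`, no new hypothesis-fact; standard axioms.
HONEST SCOPE / DIVERGENCES. (1) Exactly the hypotheses of the two instantiated files remain, per cube: the `G_□`-side (2.133) (bite (a) `…B6Ineq2133TwoScaleV1`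
+ the owner's geometry bridge (c) `…B6Prop26ReachTransplant`, p342390, to be read on `geoB`/`blkV`), the `h_□`/`ζ_□` data and reach/core sets (the rescaled
(1.118) family), the decomposition of `[h_□, Δ + Q*aQ]` into lines 1–2 of (2.92) and the line-2 partners, the own projection `P_□` of `G_□` (p. 239) and the
change-of-domain input of line 3 (p. 238 *"estimate of the type (1.12) [3]"* — not in the tree at `k` levels); the identity (2.91) itself is
`…B6Eq291Generator.eq291` (ring hypotheses `hagree`, `hinv`, `hzh`, `hhz` — the assembly's, item 6 (d)); the overlap number of the windows is the consumer's `hN`.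
(2) §4 is the special case `P_□ = ∂P∂*`, recorded for the one-domain situation of (2.38); print's `G_□` carries its own two-scale `P_□`. (3) Setting as in P7/gen 24
(Neumann box, levels `1 … k`, `m² = 0`, `L ≥ 2`, `η = L^{−k}`); constants existential on `d, L, δ_G`; the rate bookkeeping is r03's/gen 24's.  Nothing on d = 4 or
the continuum; NOT summit progress.  Unit `lit-balaban-p38` (gen 25), 2026-08-22.
-/

noncomputable section

namespace Literature.MathematicalPhysics.QuantumFieldTheory.Balaban1983to89.B6Ineq2134KFamKLevelL0

open B6Prop22KLevelCensusL0 (KIdx)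
open B6Prop22KLevelCensusEtaL0 (nK nK_pos)
open B6Ineq288MultiLevelBoxL0 (geoB geoB_M geoB_L geoB_eta dist_nonneg_geoB)
open B6RandomWalk (HasMajorant hasMajorant_mono hasMajorant_zero)
open B6Prop26Gluing (mulOp mulOp_apply LocalMajorant OutLoc outLoc_mulOp_mul outLoc_mul)
open B6Ineq2134ThetaKLevel (theta0_lt)
open B6Ineq2134ThetaKLevelL0 (XV blkV DP hasMajorant_DP ineq2134_kOff_kLevel)
open B6Ineq2134DiagKLevel (theta_pack_le)
open B6Ineq2134DiagKLevelL0 (ineq2134_kDiag_kLevel ineq2134_kDiag_kLevel_theta member_facts)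
open B6Eq291Generator (kDiag kOff kFam rOp)
open Literature.MathematicalPhysics.QuantumFieldTheory.Balaban1983to89.B6Ineq2134KFamKLevel (rOp_eq_sum outLoc_kDiag_mul outLoc_kOff_mul outLoc_kFam theta0_joint_lt)

variable {d ℓ : ℕ}

/-! ## §1  (`R` of (2.91) literally and the output localisation `hKout`: the original's `rOp_eq_sum`, `outLoc_kDiag_mul`, `outLoc_kOff_mul`,
`outLoc_kFam` are `D`-free (generic in `g : B6.Geometry`) and are opened BY NAME above — nothing to twin) -/

/-! ## §2  `h2134` for ALL pairs of the (2.91) family with ONE `θ₀ = Θ·(C_G/m + U)/M` and ONE rate -/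

/-- a local majorant restricts to a smaller reach set. [folklore] -/
private theorem localMajorant_subset {g : B6.Geometry} {X : Type} (blk : X → g.Site) {T : Module.End ℝ (X → ℝ)} {S S' : Set g.Site}
    {K : g.Site → g.Site → ℝ} (h : LocalMajorant blk T S K) (hS : S' ⊆ S) : LocalMajorant blk T S' K :=
  fun y' hy' μ B hμ x hx => h y' (hS hy') μ B hμ x (hS hx)

/-- **(2.134) FOR THE WHOLE FAMILY `K_{□,□′}` OF (2.91) ON THE GENUINE `k`-LEVEL FAMILY, ONE `θ₀ = O(M⁻¹)` AND ONE RATE FOR ALL PAIRS.**  For every rate `δ_G > 0`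
there are `M₀`, `δ ∈ (0, δ_G]`, `Θ ≥ 0` (on `d, L, δ_G` only) such that for every member with `L·M_h ≥ M₀`, constants `C_G, C₁, C_N, C_D, s, s₁, s₂, r₀ ≥ 0`,
`c_D, m > 0`, sizes `n_E, n_K` and every cube family `𝒟` with per-cube data — `G_□` (transported to `XV i`; the (2.133)-shape pair `C_G(L^jη)²e^{−δ_Gd}` /
`C₁(L^jη)e^{−δ_Gd}` on the window `T_□`, output-localised to `T_□`), `h_□` (`|h_□| ≤ 1`, supported within the blocks of `S_□ ⊆ T_□`, block-Lipschitz
`(s/M)(d + r₀)`), `ζ_□` (`0 ≤ ζ_□ ≤ 1`, `= 1` on the blocks of the core `Score_□`), the gap `m·M ≤ d(y, y″)` for `y ∉ Score_□`, `y″ ∈ S_□`, the decomposition of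
`h_□M_□ − M_□h_□` into line 1 (`Σ_e c_{□,e}E_{□,e} − c_{□,0}`, `|c_{□,e}| ≤ s₁/(ML^jη)`, `|c_{□,0}| ≤ s₂/(M(L^jη)²)`, supported over `T_□`, `#E ≤ n_E`) + line 2
(`Σ_k z_{□,k}[N_{□,k}, h_□]`-terms, `|z| ≤ 1`, (2.88)-shape majorants `C_N(L^jη)^{−2}e^{−δ_Gd}`, `#K ≤ n_K`), the own projection `∂P_□∂* =: P_□` (same shape) and
line 3 `ζ_□(∂P∂* − ∂P_□∂*)h_□` (`C_De^{−c_DM}(L^jη)^{−2}e^{−δ_Gd}`) — FOR ALL (□, □′) ∈ 𝒟²: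
`HasMajorant (blkV i) ((kFam (∂P∂*) h ζ M P □ □′·G_□′)·h_□′) (θ₀·e^{−(δ/2)d(y,y′)})`, **`θ₀ = Θ·(C_G/m + U)/M`**,
`U = n_E·s₁C₁ + s₂C_G + (n_K+1)·s·((C_N+1)C_G(1+r₀)) + C_DC_G/c_D` — the hypothesis `h2134` of `…B6Prop26Gluing.majorant_R_of_2134`, pair by pair.
[cite: Balaban1984PropagatorsII, (2.134) p.247; (2.91)–(2.93) p.239; (2.88) p.238] -/
theorem h2134_kFam_kLevel (d ℓ : ℕ) (hℓ : 1 ≤ ℓ) {δG : ℝ} (hδG : 0 < δG) :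
    ∃ M₀ δ Θ : ℝ, 0 < M₀ ∧ 0 < δ ∧ δ ≤ δG ∧ 0 ≤ Θ ∧
      ∀ i : B6Prop22KLevelCensusL0.KIdx d ℓ, M₀ ≤ ((ℓ : ℝ) + 1) * i.Mh →
        ∀ {CG C₁ CN CD cD s s₁ s₂ r₀ m : ℝ}, 0 ≤ CG → 0 ≤ C₁ → 0 ≤ CN → 0 ≤ CD → 0 < cD → 0 ≤ s → 0 ≤ s₁ → 0 ≤ s₂ → 0 ≤ r₀ → 0 < m →
        ∀ (nE nK : ℕ) {C : Type} [DecidableEq C] (Dc : Finset C) {G Ml Pl : C → Module.End ℝ (XV i → ℝ)} {h ζ c₀ : C → XV i → ℝ}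
          {T S Score : C → Set (geoB i).Site}
          {ι : Type} {DE : C → Finset ι} {E : C → ι → Module.End ℝ (XV i → ℝ)} {cf : C → ι → XV i → ℝ}
          {κ : Type} {DK : C → Finset κ} {N : C → κ → Module.End ℝ (XV i → ℝ)} {z : C → κ → XV i → ℝ},
          (∀ c ∈ Dc, (DE c).card ≤ nE) → (∀ c ∈ Dc, (DK c).card ≤ nK) →
          (∀ c ∈ Dc, mulOp (h c) * Ml c - Ml c * mulOp (h c) =
            (∑ e ∈ DE c, mulOp (cf c e) * E c e - mulOp (c₀ c)) + ∑ k ∈ DK c, mulOp (z c k) * (N c k * mulOp (h c) - mulOp (h c) * N c k)) →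
          (∀ c ∈ Dc, LocalMajorant (blkV i) (G c) (T c) (fun y y' => CG * (geoB i).len y ^ 2 * Real.exp (-(δG * (geoB i).dist y y')))) →
          (∀ c ∈ Dc, OutLoc (blkV i) (G c) (T c)) →
          (∀ c ∈ Dc, ∀ e ∈ DE c,
            LocalMajorant (blkV i) (E c e * G c) (T c) (fun y y' => C₁ * (geoB i).len y * Real.exp (-(δG * (geoB i).dist y y')))) →
          (∀ c ∈ Dc, ∀ e ∈ DE c, ∀ x, |cf c e x| ≤ s₁ / ((geoB i).M * (geoB i).len (blkV i x))) →
          (∀ c ∈ Dc, ∀ e ∈ DE c, ∀ x, cf c e x ≠ 0 → blkV i x ∈ T c) →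
          (∀ c ∈ Dc, ∀ x, |c₀ c x| ≤ s₂ / ((geoB i).M * (geoB i).len (blkV i x) ^ 2)) → (∀ c ∈ Dc, ∀ x, c₀ c x ≠ 0 → blkV i x ∈ T c) →
          (∀ c ∈ Dc, ∀ x, |h c x| ≤ 1) → (∀ c ∈ Dc, ∀ x, h c x ≠ 0 → blkV i x ∈ S c) → (∀ c ∈ Dc, S c ⊆ T c) →
          (∀ c ∈ Dc, ∀ x x', |h c x' - h c x| ≤ s / (geoB i).M * ((geoB i).dist (blkV i x) (blkV i x') + r₀)) →
          (∀ c ∈ Dc, ∀ k ∈ DK c,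
            HasMajorant (blkV i) (N c k) (fun y y'' => CN / (geoB i).len y ^ 2 * Real.exp (-(δG * (geoB i).dist y y'')))) →
          (∀ c ∈ Dc, ∀ k ∈ DK c, ∀ x, |z c k x| ≤ 1) →
          (∀ c ∈ Dc, HasMajorant (blkV i) (Pl c) (fun y y'' => CN / (geoB i).len y ^ 2 * Real.exp (-(δG * (geoB i).dist y y'')))) →
          (∀ c ∈ Dc, ∀ x, 0 ≤ ζ c x) → (∀ c ∈ Dc, ∀ x, ζ c x ≤ 1) → (∀ c ∈ Dc, ∀ x, ζ c x ≠ 1 → blkV i x ∉ Score c) →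
          (∀ c ∈ Dc, HasMajorant (blkV i) (mulOp (ζ c) * (DP i - Pl c) * mulOp (h c))
            (fun y y'' => CD * Real.exp (-(cD * (geoB i).M)) / (geoB i).len y ^ 2 * Real.exp (-(δG * (geoB i).dist y y'')))) →
          (∀ c ∈ Dc, ∀ y y'', y ∉ Score c → y'' ∈ S c → m * (geoB i).M ≤ (geoB i).dist y y'') →
          ∀ c ∈ Dc, ∀ c' ∈ Dc,
            HasMajorant (blkV i)
              ((kFam (DP i) (fun c => mulOp (h c)) (fun c => mulOp (ζ c)) Ml Pl c c' * G c') * mulOp (h c'))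
              (fun y y' => Θ * (CG / m + (nE * (s₁ * C₁) + s₂ * CG + (nK + 1) * s * ((CN + 1) * CG * (1 + r₀)) + CD * CG / cD)) *
                ((geoB i).M)⁻¹ * Real.exp (-(δ / 2 * (geoB i).dist y y'))) := by
  obtain ⟨M₁, δ₁, Θ₁, hM₁, hδ₁, hδ₁G, hΘ₁, hoff⟩ := ineq2134_kOff_kLevel d ℓ hℓ hδG
  obtain ⟨M₂, Θ₂, hM₂, hΘ₂, hdiag⟩ := ineq2134_kDiag_kLevel_theta d ℓ hδG
  refine ⟨max M₁ M₂, δ₁, max Θ₁ Θ₂, lt_max_of_lt_left hM₁, hδ₁, hδ₁G, le_max_of_le_left hΘ₁, ?_⟩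
  intro i hM CG C₁ CN CD cD s s₁ s₂ r₀ m hCG hC₁ hCN hCD hcD hs hs₁ hs₂ hr₀ hm nE nK C _ Dc G Ml Pl h ζ c₀ T S Score ι DE E cf κ DK N z hnE hnK
    hdec hG hGout hEG hcf hcfT hc₀ hc₀T hh1 hhS hST hLip hN hz hPl hζ0 hζ1 hζS hD3 hgap c hc c' hc'
  have hMi1 : M₁ ≤ ((ℓ : ℝ) + 1) * i.Mh := (le_max_left _ _).trans hM
  have hMi2 : M₂ ≤ ((ℓ : ℝ) + 1) * i.Mh := (le_max_right _ _).trans hM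
  have hMpos : 0 < (geoB i).M := (member_facts i).2.2.1
  have hMinv : 0 ≤ ((geoB i).M)⁻¹ := inv_nonneg.2 hMpos.le
  set U : ℝ := nE * (s₁ * C₁) + s₂ * CG + (nK + 1) * s * ((CN + 1) * CG * (1 + r₀)) + CD * CG / cD with hU
  have hUnn : 0 ≤ U := by rw [hU]; positivity
  have hCGm : 0 ≤ CG / m := div_nonneg hCG hm.le
  -- the common kernel dominates both packs
  have hdom : ∀ {θ δ' : ℝ} (y y' : (geoB i).Site), 0 ≤ θ → θ ≤ max Θ₁ Θ₂ * (CG / m + U) → δ₁ ≤ δ' →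
      θ * ((geoB i).M)⁻¹ * Real.exp (-(δ' / 2 * (geoB i).dist y y')) ≤
        max Θ₁ Θ₂ * (CG / m + U) * ((geoB i).M)⁻¹ * Real.exp (-(δ₁ / 2 * (geoB i).dist y y')) := by
    intro θ δ' y y' hθ hθle hδ'
    refine mul_le_mul (mul_le_mul_of_nonneg_right hθle hMinv) (Real.exp_le_exp.2 (neg_le_neg ?_)) (Real.exp_nonneg _)
      (mul_nonneg (hθ.trans hθle) hMinv)
    exact mul_le_mul_of_nonneg_right (by linarith) (dist_nonneg_geoB i y y')
  by_cases hcc : c = c'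
  · -- the diagonal pair: (2.92), `kDiag`
    subst hcc
    have e : kFam (DP i) (fun c => mulOp (h c)) (fun c => mulOp (ζ c)) Ml Pl c c = kDiag (DP i) (mulOp (h c)) (mulOp (ζ c)) (Ml c) (Pl c) := by
      simp [kFam]
    rw [e]
    have hζabs : ∀ x, |ζ c x| ≤ 1 := fun x => abs_le.2 ⟨by linarith [hζ0 c hc x], hζ1 c hc x⟩
    have hhT : ∀ x, h c x ≠ 0 → blkV i x ∈ T c := fun x hx => hST c hc (hhS c hc x hx)
    have key := hdiag i hMi2 (blkV i) (DP i) hCG hC₁ hCN hCD hcD hs hs₁ hs₂ hr₀ (DE c) (DK c) (hdec c hc) (hG c hc) (hGout c hc) (hEG c hc)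
      (hcf c hc) (hcfT c hc) (hc₀ c hc) (hc₀T c hc) (hh1 c hc) hhT (hLip c hc) (hN c hc) (hz c hc) (hPl c hc) hζabs (hD3 c hc)
    refine hasMajorant_mono _ key fun y y' => ?_
    have hUc : (((DE c).card : ℝ) * (s₁ * C₁) + s₂ * CG + ((DK c).card + 1) * s * ((CN + 1) * CG * (1 + r₀)) + CD * CG / cD) ≤ U := by
      have h1 : ((DE c).card : ℝ) ≤ nE := by exact_mod_cast hnE c hc
      have h2 : ((DK c).card : ℝ) ≤ nK := by exact_mod_cast hnK c hc
      have h3 : 0 ≤ s₁ * C₁ := by positivity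
      have h4 : 0 ≤ s * ((CN + 1) * CG * (1 + r₀)) := by positivity
      rw [hU]; nlinarith
    have hUc0 : 0 ≤ (((DE c).card : ℝ) * (s₁ * C₁) + s₂ * CG + ((DK c).card + 1) * s * ((CN + 1) * CG * (1 + r₀)) + CD * CG / cD) := by
      positivity
    refine hdom y y' (mul_nonneg hΘ₂ hUc0) ?_ hδ₁G
    calc Θ₂ * (((DE c).card : ℝ) * (s₁ * C₁) + s₂ * CG + ((DK c).card + 1) * s * ((CN + 1) * CG * (1 + r₀)) + CD * CG / cD)
        ≤ max Θ₁ Θ₂ * U := mul_le_mul (le_max_right _ _) hUc hUc0 (le_max_of_le_left hΘ₁)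
      _ ≤ max Θ₁ Θ₂ * (CG / m + U) := mul_le_mul_of_nonneg_left (by linarith) (le_max_of_le_left hΘ₁)
  · -- an off-diagonal pair: (2.93), `kOff`
    have e : kFam (DP i) (fun c => mulOp (h c)) (fun c => mulOp (ζ c)) Ml Pl c c' = kOff (DP i) (mulOp (h c)) (mulOp (ζ c')) (mulOp (h c')) := by
      simp [kFam, hcc]
    rw [e]
    have hGS : LocalMajorant (blkV i) (G c') (S c') (fun y y' => CG * (geoB i).len y ^ 2 * Real.exp (-(δG * (geoB i).dist y y'))) :=
      localMajorant_subset _ (hG c' hc') (hST c' hc')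
    have key := hoff i hMi1 hCG hm (Gl := G c') hGS (hh1 c hc) (hζ0 c' hc') (hζ1 c' hc') (hζS c' hc') (hh1 c' hc') (hhS c' hc') (hgap c' hc')
    refine hasMajorant_mono _ key fun y y' => ?_
    have e2 : Θ₁ * CG / m * ((geoB i).M)⁻¹ = Θ₁ * (CG / m) * ((geoB i).M)⁻¹ := by ring
    rw [e2]
    refine hdom y y' (mul_nonneg hΘ₁ hCGm) ?_ le_rfl
    calc Θ₁ * (CG / m) ≤ max Θ₁ Θ₂ * (CG / m) := mul_le_mul_of_nonneg_right (le_max_left _ _) hCGm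
      _ ≤ max Θ₁ Θ₂ * (CG / m + U) := mul_le_mul_of_nonneg_left (by linarith) (le_max_of_le_left hΘ₁)

/-! ## §3  The inputs `h2134` + `hsmall` of the gluing, above ONE threshold -/

/-- **THE INPUTS `h2134` AND `hsmall` OF `…B6Prop26Gluing.prop26_2136_of_2133_2134` ON THE GENUINE `k`-LEVEL FAMILY, ABOVE ONE THRESHOLD**: for `δ_G > 0`,
constants `C_G, C₁, C_N, C_D, s, s₁, s₂, r₀ ≥ 0`, `c_D, m > 0`, sizes `n_E, n_K`, an overlap number `N` and a walk constant `c₁ ≥ 0` there are `M₁`, `δ ∈ (0, δ_G]`,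
`Θ ≥ 0` such that every member with `L·M_h ≥ M₁` has BOTH `N²θ₀c₁ < 1` AND, for every cube family with the data of `h2134_kFam_kLevel`, the majorant `θ₀e^{−(δ/2)d}`
of `(K_{□,□′}G_{□′})·h_{□′}` for ALL pairs, `θ₀ = Θ·(C_G/m + U)/M` (with `hR` := `rOp_eq_sum`, `hKout` := `outLoc_kFam`).
[cite: Balaban1984PropagatorsII, (2.134)–(2.135) p.247; Prop. 2.6 p.247; (2.91) p.239] -/
theorem inputs2134_kFam_kLevel (d ℓ : ℕ) (hℓ : 1 ≤ ℓ) {δG CG C₁ CN CD cD s s₁ s₂ r₀ m c₁ : ℝ} (nE nK Nov : ℕ) (hδG : 0 < δG) (hCG : 0 ≤ CG)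
    (hC₁ : 0 ≤ C₁) (hCN : 0 ≤ CN) (hCD : 0 ≤ CD) (hcD : 0 < cD) (hs : 0 ≤ s) (hs₁ : 0 ≤ s₁) (hs₂ : 0 ≤ s₂) (hr₀ : 0 ≤ r₀) (hm : 0 < m)
    (hc₁ : 0 ≤ c₁) :
    ∃ M₁ δ Θ : ℝ, 0 < M₁ ∧ 0 < δ ∧ δ ≤ δG ∧ 0 ≤ Θ ∧
      ∀ i : B6Prop22KLevelCensusL0.KIdx d ℓ, M₁ ≤ ((ℓ : ℝ) + 1) * i.Mh →
        (Nov : ℝ) ^ 2 * (Θ * (CG / m + (nE * (s₁ * C₁) + s₂ * CG + (nK + 1) * s * ((CN + 1) * CG * (1 + r₀)) + CD * CG / cD)) * ((geoB i).M)⁻¹) *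
            c₁ < 1 ∧
        ∀ {C : Type} [DecidableEq C] (Dc : Finset C) {G Ml Pl : C → Module.End ℝ (XV i → ℝ)} {h ζ c₀ : C → XV i → ℝ}
          {T S Score : C → Set (geoB i).Site}
          {ι : Type} {DE : C → Finset ι} {E : C → ι → Module.End ℝ (XV i → ℝ)} {cf : C → ι → XV i → ℝ}
          {κ : Type} {DK : C → Finset κ} {N : C → κ → Module.End ℝ (XV i → ℝ)} {z : C → κ → XV i → ℝ},
          (∀ c ∈ Dc, (DE c).card ≤ nE) → (∀ c ∈ Dc, (DK c).card ≤ nK) →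
          (∀ c ∈ Dc, mulOp (h c) * Ml c - Ml c * mulOp (h c) =
            (∑ e ∈ DE c, mulOp (cf c e) * E c e - mulOp (c₀ c)) + ∑ k ∈ DK c, mulOp (z c k) * (N c k * mulOp (h c) - mulOp (h c) * N c k)) →
          (∀ c ∈ Dc, LocalMajorant (blkV i) (G c) (T c) (fun y y' => CG * (geoB i).len y ^ 2 * Real.exp (-(δG * (geoB i).dist y y')))) →
          (∀ c ∈ Dc, OutLoc (blkV i) (G c) (T c)) →
          (∀ c ∈ Dc, ∀ e ∈ DE c,
            LocalMajorant (blkV i) (E c e * G c) (T c) (fun y y' => C₁ * (geoB i).len y * Real.exp (-(δG * (geoB i).dist y y')))) →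
          (∀ c ∈ Dc, ∀ e ∈ DE c, ∀ x, |cf c e x| ≤ s₁ / ((geoB i).M * (geoB i).len (blkV i x))) →
          (∀ c ∈ Dc, ∀ e ∈ DE c, ∀ x, cf c e x ≠ 0 → blkV i x ∈ T c) →
          (∀ c ∈ Dc, ∀ x, |c₀ c x| ≤ s₂ / ((geoB i).M * (geoB i).len (blkV i x) ^ 2)) → (∀ c ∈ Dc, ∀ x, c₀ c x ≠ 0 → blkV i x ∈ T c) →
          (∀ c ∈ Dc, ∀ x, |h c x| ≤ 1) → (∀ c ∈ Dc, ∀ x, h c x ≠ 0 → blkV i x ∈ S c) → (∀ c ∈ Dc, S c ⊆ T c) →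
          (∀ c ∈ Dc, ∀ x x', |h c x' - h c x| ≤ s / (geoB i).M * ((geoB i).dist (blkV i x) (blkV i x') + r₀)) →
          (∀ c ∈ Dc, ∀ k ∈ DK c,
            HasMajorant (blkV i) (N c k) (fun y y'' => CN / (geoB i).len y ^ 2 * Real.exp (-(δG * (geoB i).dist y y'')))) →
          (∀ c ∈ Dc, ∀ k ∈ DK c, ∀ x, |z c k x| ≤ 1) →
          (∀ c ∈ Dc, HasMajorant (blkV i) (Pl c) (fun y y'' => CN / (geoB i).len y ^ 2 * Real.exp (-(δG * (geoB i).dist y y'')))) →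
          (∀ c ∈ Dc, ∀ x, 0 ≤ ζ c x) → (∀ c ∈ Dc, ∀ x, ζ c x ≤ 1) → (∀ c ∈ Dc, ∀ x, ζ c x ≠ 1 → blkV i x ∉ Score c) →
          (∀ c ∈ Dc, HasMajorant (blkV i) (mulOp (ζ c) * (DP i - Pl c) * mulOp (h c))
            (fun y y'' => CD * Real.exp (-(cD * (geoB i).M)) / (geoB i).len y ^ 2 * Real.exp (-(δG * (geoB i).dist y y'')))) →
          (∀ c ∈ Dc, ∀ y y'', y ∉ Score c → y'' ∈ S c → m * (geoB i).M ≤ (geoB i).dist y y'') →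
          ∀ c ∈ Dc, ∀ c' ∈ Dc,
            HasMajorant (blkV i)
              ((kFam (DP i) (fun c => mulOp (h c)) (fun c => mulOp (ζ c)) Ml Pl c c' * G c') * mulOp (h c'))
              (fun y y' => Θ * (CG / m + (nE * (s₁ * C₁) + s₂ * CG + (nK + 1) * s * ((CN + 1) * CG * (1 + r₀)) + CD * CG / cD)) *
                ((geoB i).M)⁻¹ * Real.exp (-(δ / 2 * (geoB i).dist y y'))) := by
  obtain ⟨M₀, δ, Θ, hM₀, hδ, hδG', hΘ, hall⟩ := h2134_kFam_kLevel d ℓ hℓ hδG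
  have hV : 0 ≤ CG / m + (nE * (s₁ * C₁) + s₂ * CG + (nK + 1) * s * ((CN + 1) * CG * (1 + r₀)) + CD * CG / cD) := by
    have := div_nonneg hCG hm.le
    positivity
  obtain ⟨M₂, hM₂, hsmall⟩ := theta0_joint_lt (Θ := Θ) Nov hΘ hV hc₁
  refine ⟨max M₀ M₂, δ, Θ, lt_max_of_lt_left hM₀, hδ, hδG', hΘ, fun i hM => ⟨?_, ?_⟩⟩
  · exact hsmall _ (by rw [geoB_M]; exact (le_max_right _ _).trans hM)
  · intro C _ Dc G Ml Pl h ζ c₀ T S Score ι DE E cf κ DK N z hnE hnK hdec hG hGout hEG hcf hcfT hc₀ hc₀T hh1 hhS hST hLip hN hz hPl hζ0 hζ1 hζS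
      hD3 hgap
    exact hall i ((le_max_left _ _).trans hM) hCG hC₁ hCN hCD hcD hs hs₁ hs₂ hr₀ hm nE nK Dc hnE hnK hdec hG hGout hEG hcf hcfT hc₀ hc₀T hh1 hhS
      hST hLip hN hz hPl hζ0 hζ1 hζS hD3 hgap

/-! ## §4  The special case `P_□ = ∂P∂*`: the line-4 partner genuine and discharged -/

/-- monotonicity of a local majorant in the kernel. [folklore] -/
private theorem localMajorant_mono {g : B6.Geometry} {X : Type} (blk : X → g.Site) {T : Module.End ℝ (X → ℝ)} {S : Set g.Site}
    {K K' : g.Site → g.Site → ℝ} (h : LocalMajorant blk T S K) (hle : ∀ a b, K a b ≤ K' a b) : LocalMajorant blk T S K' :=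
  fun y' hy' μ B hμ x hx => (h y' hy' μ B hμ x hx).trans (mul_le_mul_of_nonneg_right (hle _ _) hμ.nonneg)

/-- lowering the rate / raising the constant of an exponential majorant on non-negative distances. [folklore] -/
private theorem expKernel_mono {c c' δ δ' t : ℝ} (hc' : 0 ≤ c') (hc : c ≤ c') (hδ : δ' ≤ δ) (ht : 0 ≤ t) :
    c * Real.exp (-(δ * t)) ≤ c' * Real.exp (-(δ' * t)) :=
  (mul_le_mul_of_nonneg_right hc (Real.exp_nonneg _)).trans
    (mul_le_mul_of_nonneg_left (Real.exp_le_exp.2 (neg_le_neg (mul_le_mul_of_nonneg_right hδ ht))) hc')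

/-- `max(a, b) ≤ (a+1)(b+1)` for `a, b ≥ 0`. [folklore] -/
private theorem max_le_mul_succ {a b : ℝ} (ha : 0 ≤ a) (hb : 0 ≤ b) : max a b ≤ (a + 1) * (b + 1) := max_le (by nlinarith) (by nlinarith)

/-- raising the constant / lowering the rate of a (2.88)-shape majorant. [folklore] -/
private theorem hasMajorant_constMono (i : KIdx d ℓ) {T : Module.End ℝ (XV i → ℝ)} {C C' δ δ' : ℝ} (hC' : 0 ≤ C') (hC : C ≤ C') (hδ : δ' ≤ δ)
    (h : HasMajorant (blkV i) T (fun y y'' => C / (geoB i).len y ^ 2 * Real.exp (-(δ * (geoB i).dist y y'')))) :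
    HasMajorant (blkV i) T (fun y y'' => C' / (geoB i).len y ^ 2 * Real.exp (-(δ' * (geoB i).dist y y''))) := by
  refine hasMajorant_mono _ h fun y y'' => ?_
  have hl : 0 ≤ ((geoB i).len y ^ 2)⁻¹ := inv_nonneg.2 (sq_nonneg _)
  rw [div_eq_mul_inv, div_eq_mul_inv, mul_assoc, mul_assoc]
  refine mul_le_mul hC ?_ (mul_nonneg hl (Real.exp_nonneg _)) hC'
  exact mul_le_mul_of_nonneg_left (Real.exp_le_exp.2 (neg_le_neg (mul_le_mul_of_nonneg_right hδ (dist_nonneg_geoB i y y'')))) hl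

/-- **THE SPECIAL CASE `P_□ = ∂P∂*` (no change of domain: line 3 of (2.92) absent, `…B6Eq291Generator.kDiag_noDomainChange`), THE LINE-4 PARTNER GENUINE
AND DISCHARGED.**  With `Pl := DP i` = gen 24's genuine `k`-level `∂P∂*`, line 4 is `ζ_□[∂P∂*, h_□]` and its (2.88) majorant is `hasMajorant_DP` (P7's
`ineq288_kLevelP` BY NAME): for every rate `δ_G > 0` there are `M₀`, `δ ∈ (0, δ_G]` (`= min(δ_P, δ_G)`), `Θ ≥ 0` (on `d, L, δ_G`) such that for every member
with `L·M_h ≥ M₀` and all data as in `ineq2134_kDiag_kLevel_theta` WITHOUT `Pl` and line 3: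
`HasMajorant (blkV i) ((kDiag (∂P∂*) h_□ ζ_□ M_□ (∂P∂*)·G_□)·h_□) (Θ·U·M⁻¹·e^{−(δ/2)d})`, `U = #E·s₁C₁ + s₂C_G + (#K+1)·s·((C_N+1)C_G(1+r₀))`.  (Print's
`G_□` carries its own two-scale `P_□` on `T_□`, p. 239 — that is `ineq2134_kDiag_kLevel_theta`; this corollary records the one-domain situation of (2.38)
and the `M`-dependence with every operator genuine.) [cite: Balaban1984PropagatorsII, (2.134) p.247; (2.92) p.239; (2.88) p.238; (2.38) p.229] -/
theorem ineq2134_kDiag_kLevel_noDomainChange (d ℓ : ℕ) (hℓ : 1 ≤ ℓ) {δG : ℝ} (hδG : 0 < δG) :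
    ∃ M₀ δ Θ : ℝ, 0 < M₀ ∧ 0 < δ ∧ δ ≤ δG ∧ 0 ≤ Θ ∧
      ∀ i : B6Prop22KLevelCensusL0.KIdx d ℓ, M₀ ≤ ((ℓ : ℝ) + 1) * i.Mh →
        ∀ {CG C₁ CN s s₁ s₂ r₀ : ℝ}, 0 ≤ CG → 0 ≤ C₁ → 0 ≤ CN → 0 ≤ s → 0 ≤ s₁ → 0 ≤ s₂ → 0 ≤ r₀ →
        ∀ {Gl Ml : Module.End ℝ (XV i → ℝ)} {hI c₀ ζ : XV i → ℝ} {S : Set (geoB i).Site}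
          {ι : Type} (DE : Finset ι) {E : ι → Module.End ℝ (XV i → ℝ)} {cf : ι → XV i → ℝ}
          {κ : Type} (DK : Finset κ) {N : κ → Module.End ℝ (XV i → ℝ)} {z : κ → XV i → ℝ},
          mulOp hI * Ml - Ml * mulOp hI =
            (∑ e ∈ DE, mulOp (cf e) * E e - mulOp c₀) + ∑ k ∈ DK, mulOp (z k) * (N k * mulOp hI - mulOp hI * N k) →
          LocalMajorant (blkV i) Gl S (fun y y' => CG * (geoB i).len y ^ 2 * Real.exp (-(δG * (geoB i).dist y y'))) →
          OutLoc (blkV i) Gl S →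
          (∀ e ∈ DE, LocalMajorant (blkV i) (E e * Gl) S (fun y y' => C₁ * (geoB i).len y * Real.exp (-(δG * (geoB i).dist y y')))) →
          (∀ e ∈ DE, ∀ x, |cf e x| ≤ s₁ / ((geoB i).M * (geoB i).len (blkV i x))) → (∀ e ∈ DE, ∀ x, cf e x ≠ 0 → blkV i x ∈ S) →
          (∀ x, |c₀ x| ≤ s₂ / ((geoB i).M * (geoB i).len (blkV i x) ^ 2)) → (∀ x, c₀ x ≠ 0 → blkV i x ∈ S) →
          (∀ x, |hI x| ≤ 1) → (∀ x, hI x ≠ 0 → blkV i x ∈ S) →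
          (∀ x x', |hI x' - hI x| ≤ s / (geoB i).M * ((geoB i).dist (blkV i x) (blkV i x') + r₀)) →
          (∀ k ∈ DK, HasMajorant (blkV i) (N k) (fun y y'' => CN / (geoB i).len y ^ 2 * Real.exp (-(δG * (geoB i).dist y y'')))) →
          (∀ k ∈ DK, ∀ x, |z k x| ≤ 1) → (∀ x, |ζ x| ≤ 1) →
          HasMajorant (blkV i) ((kDiag (DP i) (mulOp hI) (mulOp ζ) Ml (DP i) * Gl) * mulOp hI)
            (fun y y' => Θ * (DE.card * (s₁ * C₁) + s₂ * CG + (DK.card + 1) * s * ((CN + 1) * CG * (1 + r₀))) * ((geoB i).M)⁻¹ *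
              Real.exp (-(δ / 2 * (geoB i).dist y y'))) := by
  -- the genuine `∂P∂*` and its (2.88) majorant; the common rate `δ = min(δ_P, δ_G)`
  obtain ⟨M₃, δP, CP, hM₃, hδP, hCP, hDP⟩ := hasMajorant_DP d ℓ hℓ
  obtain ⟨δ, hδdef⟩ : ∃ δ : ℝ, δ = min δP δG := ⟨_, rfl⟩
  have hδ : 0 < δ := by rw [hδdef]; exact lt_min hδP hδG
  have hδP' : δ ≤ δP := by rw [hδdef]; exact min_le_left _ _
  have hδG' : δ ≤ δG := by rw [hδdef]; exact min_le_right _ _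
  obtain ⟨M₀, c, hM₀, hc, hall⟩ := ineq2134_kDiag_kLevel d ℓ hδ
  obtain ⟨Θ, hΘ⟩ : ∃ Θ : ℝ, Θ = ((ℓ : ℝ) + 1) ^ 2 * c ^ 2 * (CP + 1) * (8 / δ + 1) + 1 := ⟨_, rfl⟩
  have hΘnn : 0 ≤ Θ := by rw [hΘ]; have := hCP.le; positivity
  refine ⟨max M₀ M₃, δ, Θ, lt_max_of_lt_left hM₀, hδ, hδG', hΘnn, ?_⟩
  intro i hM CG C₁ CN s s₁ s₂ r₀ hCG hC₁ hCN hs hs₁ hs₂ hr₀ Gl Ml hI c₀ ζ S ι DE E cf κ DK N z hdec hG hGout hEG hcf hcfS hc₀ hc₀S hI1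
    hIS hLip hN hz hζ
  have hM0 : M₀ ≤ ((ℓ : ℝ) + 1) * i.Mh := (le_max_left _ _).trans hM
  have hM3 : M₃ ≤ ((ℓ : ℝ) + 1) * i.Mh := (le_max_right _ _).trans hM
  obtain ⟨hL1, hη, hMpos, -⟩ := member_facts i
  have hlen : ∀ y : (geoB i).Site, 0 ≤ (geoB i).len y := fun y =>
    (mul_pos (pow_pos (lt_of_lt_of_le zero_lt_one hL1) _) hη).le
  have hCN' : 0 ≤ max CN CP := le_max_of_le_left hCN
  -- the inputs at the common rate `δ`, the partners with the common constant `max(C_N, C_P)`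
  have hG' : LocalMajorant (blkV i) Gl S (fun y y' => CG * (geoB i).len y ^ 2 * Real.exp (-(δ * (geoB i).dist y y'))) :=
    localMajorant_mono _ hG fun y y' => expKernel_mono (mul_nonneg hCG (sq_nonneg _)) le_rfl hδG' (dist_nonneg_geoB i y y')
  have hEG' : ∀ e ∈ DE, LocalMajorant (blkV i) (E e * Gl) S (fun y y' => C₁ * (geoB i).len y * Real.exp (-(δ * (geoB i).dist y y'))) :=
    fun e he => localMajorant_mono _ (hEG e he) fun y y' =>
      expKernel_mono (mul_nonneg hC₁ (hlen y)) le_rfl hδG' (dist_nonneg_geoB i y y')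
  have hN' : ∀ k ∈ DK, HasMajorant (blkV i) (N k) (fun y y'' => max CN CP / (geoB i).len y ^ 2 * Real.exp (-(δ * (geoB i).dist y y''))) :=
    fun k hk => hasMajorant_constMono i hCN' (le_max_left _ _) hδG' (hN k hk)
  have hP' : HasMajorant (blkV i) (DP i) (fun y y'' => max CN CP / (geoB i).len y ^ 2 * Real.exp (-(δ * (geoB i).dist y y''))) :=
    hasMajorant_constMono i hCN' (le_max_right _ _) hδP' (hDP i hM3)
  -- line 3 vanishes: `ζ(∂P∂* − ∂P∂*)h = 0`
  have hD : HasMajorant (blkV i) (mulOp ζ * (DP i - DP i) * mulOp hI)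
      (fun y y'' => 0 * Real.exp (-(1 * (geoB i).M)) / (geoB i).len y ^ 2 * Real.exp (-(δ * (geoB i).dist y y''))) := by
    rw [sub_self, mul_zero, zero_mul]
    refine hasMajorant_mono _ (hasMajorant_zero _) fun y y'' => le_of_eq ?_
    simp
  have key := hall i hM0 (blkV i) (DP i) hCG hC₁ hCN' le_rfl hs hs₁ hs₂ hr₀ (cD := 1) (Pl := DP i) DE DK hdec hG' hGout hEG' hcf hcfS hc₀
    hc₀S hI1 hIS hLip hN' hz hP' hζ hD
  refine hasMajorant_mono _ key fun y y' => ?_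
  have hθ := theta_pack_le (L := (geoB i).L) (c := c) (CP := CP) (CN' := max CN CP) DE.card DK.card hMpos hδ hCP.le hCN'
    (max_le_mul_succ hCN hCP.le) hCN hCG hC₁ le_rfl zero_lt_one hs hs₁ hs₂ hr₀
  rw [geoB_L] at hθ ⊢
  rw [← hΘ] at hθ
  have h0 : ((DE.card : ℝ) * (s₁ * C₁) + s₂ * CG + (DK.card + 1) * s * ((CN + 1) * CG * (1 + r₀)) + 0 * CG / 1) =
      (DE.card : ℝ) * (s₁ * C₁) + s₂ * CG + (DK.card + 1) * s * ((CN + 1) * CG * (1 + r₀)) := by ring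
  rw [h0] at hθ
  have h1 : Real.exp (-(1 / 2 * δ * (geoB i).dist y y')) = Real.exp (-(δ / 2 * (geoB i).dist y y')) := by ring_nf
  rw [h1]
  exact mul_le_mul_of_nonneg_right hθ (Real.exp_nonneg _)

end Literature.MathematicalPhysics.QuantumFieldTheory.Balaban1983to89.B6Ineq2134KFamKLevelL0
end
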